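import Literature.AlgebraicGeometry.HodgeTheory.BlochSemiregularSpread
import Literature.AlgebraicGeometry.HodgeTheory.AlgebraicityLocusIUnionClosedProofs
import Literature.AlgebraicGeometry.Motives.VeryGeneralComplexPoint
import Literature.AlgebraicGeometry.HodgeTheory.IsoTransport
import Literature.AlgebraicGeometry.HodgeTheory.FlatSectionNonvanishing
import Literature.AlgebraicGeometry.HodgeTheory.HodgeTypeConjugation
import Literature.AlgebraicGeometry.HodgeTheory.TopDegreeClasses
import Literature.AlgebraicGeometry.HodgeTheory.ComplexConjugationHolds
import Literature.AlgebraicGeometry.Deligne1982.CMDenseMumfordTateFamilies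
import Literature.AlgebraicGeometry.Motives.AbelianVarietyProjectiveChart
import Summits.HodgeConjecture.HodgeConjecture.Theorems.PadicSemiregularLiftHodgeAbelianVarietiesStubCmAnchoredFamilies
import HarnessLib

/-!
# Venture HSemireg (cell `pub-hsemireg`) — the CM-ANCHORED TRANSFER CHAIN, Remark-(7.5) and UNIFORM forms:
# «a·(class) + (fibrewise-algebraic class) carried by a semiregular lci at a CM fibre of the Mumford–Tate
# family ⟹ the class is algebraic on EVERY fibre»; and «CM-density ∧ Bloch ∧ a uniform, FAMILY-AWARE
# semiregular-seed hypothesis at CM fibres ⟹ the Hodge conjecture for all complex abelian varieties»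

HONEST FRAMING. Lean index of a COMPUTATION cell (THEORY SEAT 2). Nothing here is a claim about the Hodge
conjecture: every published theorem enters as a hypothesis BY NAME, the open input is explicit data
(Theorem 1′) or the `@[conjecture]` hypothesis `UniformCMBlochSeeds` (Theorem 2′), never asserted. No number
computed by the cell is used. Companion of `CMAnchoredChain.lean` (Theorem 1 = the case `a = 1`, `H = 0`;
its ∀-form hypothesis `CMBlochSeeds` is the NAIVE family-free form — see the correction below), of
`HodgeLociCMPoints.lean` (arrow (1) on literal Hodge-locus components) and of the general-structure team's
`GeneralStructureWiringBloch.lean` (`UniformBlochLiftAtCM`, the same idea routed through ring 2).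

## Correction recorded here (seat self-review, red-team lens)

The naive ∀-form `CMAnchoredChain.CMBlochSeeds` («every NON-ZERO rational `(p,p)` class on a CM abelian
variety, `1 ≤ p < dim`, is supported on ONE integral Bloch-semiregular lci») is FALSE in mathematics: on
`E × E` (`E` a CM elliptic curve) the class `x = [E×0] - [0×E]` is rational, of type `(1,1)`, non-zero, and
`x² = -2 < 0`, while every integral curve `C` on an abelian surface has `C² ≥ 0`; a class supported on an
integral curve `C` is a multiple of `[C]` (purity), so no seed carries `x`. Hence Theorem 2 of that file,
though kernel-correct, has an unsatisfiable third hypothesis. Bloch's own formulation avoids this — Remark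
(7.5): «there exist integers `a, b`, `a ≠ 0`, such that `a z₀ + b l₀ᵖ` is the class of a subscheme `Z₀ ⊂ X₀`
which is semi-regular and a local complete intersection» (for `x` above: `x + ([E×0]+[0×E]) = 2[E×0]`,
and `E × 0` IS Bloch-semiregular) — and so does the cell's object `HasBlochSeedAt` (`[Z] = q·hⁿ + w`). This
file types that form: a rational scalar `a ≠ 0` and a correction by a global class `H` ALGEBRAIC ON EVERY
FIBRE (so that it transports trivially), whence a FAMILY-AWARE hypothesis, as in the general-structure
team's `UniformBlochLiftAtCM`. (A kernel proof of `¬ CMBlochSeeds` needs the intersection form of `E × E`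
and purity for curves on surfaces; left to a refuter seat — recorded in `HOME/theory/TH2-CHAIN-ARROWS.md`.)

## Contents

* THEOREM 1′ `hodgeClass_algebraic_of_blochSeed_on_cmDenseFamily_of_smul_add`: `BlochSemiregularSpread
  (dim A) p` + the data (a)(b) of a Deligne–Charles–Schnell family through `(A, c)` + at ONE fibre
  `𝒳_{s₀} ≅ A₀` (in the cell: a CM fibre) an integral Bloch-semiregular lci carrying
  `e₀^*((a·W + H)|_{𝒳_{s₀}})`, `a ∈ ℚ^×`, `H` fibrewise rational `(p,p)` and algebraic ⟹ `W|_{𝒳_t}`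
  algebraic for every `t` and `c ∈ algebraicClasses A p`.
* `UniformCMBlochSeeds` (`@[conjecture]`, BY NAME, never asserted) — the family-aware ∀-form at CM fibres
  of Mumford–Tate families (clauses of `IsCMDenseMumfordTateFamilyFor`), with the vanishing alternative.
* THEOREM 2′ `hodgeConjectureFor_abelian_of_cmDense_of_blochSpread_of_uniformCMBlochSeeds`:
  `deligne1982_cmDenseMumfordTateFamilies → (∀ n p, BlochSemiregularSpread n p) → UniformCMBlochSeeds →
  ∀ A, HodgeConjectureFor A.dim A.X` — CM density USED (a CM fibre exists), flatness
  (`FiberClass.cls_ne_zero_of_isSmoothProjectiveFamily`) for the vanishing alternative, degrees `0`, `dim`,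
  `> dim` unconditional (`algebraicClasses_zero`, `mem_algebraicClasses_of_degree_top`,
  `subsingleton_complexBetti`). Neither `HC_CM` nor Catanese 2002 nor André–Oort nor any finiteness of
  Mumford–Tate types is an input.

## References (hypotheses by name; statements as printed in the cited tree files)

* [Bloch1972Semiregularity] Thm. (7.4), Remark (7.5), p. 65; [BuchweitzFlenner2003] Thm. 5.2.
* [Deligne1982HodgeCycles] Prop. 6.1 and proof pp. 71–73, §5; [CharlesSchnell2014Notes] Thm. 11.5.11, Prop. 11.3.11.
* [CarlsonMullerStachPeters2017] Prop. 17.1.2, Cor. 17.1.5; [MoonenOort2013Torelli] §3 (b), §3 (CM = special points).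
-/

noncomputable section

open CategoryTheory AlgebraicGeometry

namespace Summit.Ventures.HSemireg

open Literature.AlgebraicGeometry Literature.AlgebraicGeometry.Motives
open Literature.AlgebraicGeometry.HodgeTheory Literature.AlgebraicGeometry.Deligne1982
open Literature.AlgebraicGeometry.Milne1999

local notation3 (prettyPrint := false) "Res[" f ", " s ", " k ", " A "]" =>
  complexBetti.map (Motives.fiberι f s) k A

/-! ### Bloch's last paragraph: algebraic on a non-empty open set ⟹ algebraic everywhere -/

/-- (Private; = `ComplexPoints.exists_eq_univ_of_isOpen_subset_iUnion` of `BlochSemiregularSpreadGlobal.lean`.)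
A non-empty analytic open subset of `S(ℂ)`, `S` irreducible, separated and locally of finite type over `ℂ`,
is not covered by countably many PROPER Zariski-closed subsets (Baire: `dense_setOf_forall_pt_not_mem`) —
Bloch 1972, proof of (7.4), last paragraph: «Since `U ⊂ T`, it follows that `T = S`».
[cite: Bloch1972Semiregularity, proof of Thm. (7.4), last paragraph (p. 65)] -/
private theorem exists_eq_univ_of_isOpen_subset_iUnion {S : SchemeOver ℂ} [IsSeparated S.hom]
    [LocallyOfFiniteType S.hom] [IrreducibleSpace S.left] {W : ℕ → Set S.left}
    (hW : ∀ j, IsClosed (W j)) {U : Set (ComplexPoints S)} (hU : IsOpen U) (hUne : U.Nonempty)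
    (hUW : U ⊆ ⋃ j, {t : ComplexPoints S | t.pt ∈ W j}) : ∃ j, W j = Set.univ := by
  by_contra h
  push Not at h
  have hd : Dense {t : ComplexPoints S | ∀ j, t.pt ∉ W j} := ComplexPoints.dense_setOf_forall_pt_not_mem hW h
  obtain ⟨t, htU, ht⟩ := hd.inter_open_nonempty U hU hUne
  obtain ⟨j, hj⟩ := Set.mem_iUnion.1 (hUW htU)
  exact ht j hj

/-- (Private; = `charlesSchnell_algebraicityLocus_iUnion_closed.forall_mem_algebraicClasses_of_isOpen` of
`BlochSemiregularSpreadGlobal.lean`, with the structure theorem DISCHARGED.) For a smooth projective family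
over a smooth irreducible quasi-projective base and a global class `W`, algebraicity of `W|_{𝒳_t}` on a
non-empty open set of `t` implies it for every `t`: the algebraicity locus is `⋃ⱼ Wⱼ(ℂ)` with `Wⱼ ⊆ S`
closed (Charles–Schnell Prop. 11.3.11, the tree's theorem `charlesSchnell_algebraicityLocus_iUnion_closed_holds`).
[cite: CharlesSchnell2014Notes, Prop. 11.3.11 (proof)] [cite: Bloch1972Semiregularity, proof of Thm. (7.4) (p. 65)] -/
private theorem forall_mem_algebraicClasses_of_isOpen {𝒳 S : SchemeOver ℂ} (f : 𝒳 ⟶ S) (n p : ℕ)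
    (h𝒳 : IsQuasiProjectiveOver 𝒳) (hS : IsQuasiProjectiveOver S) (hSm : Smooth S.hom)
    (hf : IsSmoothProjectiveFamily f n) [IrreducibleSpace S.left] (W : complexBetti 𝒳 (2 * p))
    {U : Set (ComplexPoints S)} (hU : IsOpen U) (hUne : U.Nonempty)
    (hUA : ∀ t ∈ U, Res[f, t, 2 * p, W] ∈ algebraicClasses (fiberOver f t) p) (t : ComplexPoints S) :
    Res[f, t, 2 * p, W] ∈ algebraicClasses (fiberOver f t) p := by
  haveI : LocallyOfFiniteType S.hom := hS.locallyOfFiniteType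
  haveI : IsSeparated S.hom := by
    obtain ⟨P, j, hP, hj⟩ := hS
    haveI := hj
    haveI : IsProper P.hom := hP.isProper
    rw [← Over.w j]
    infer_instance
  obtain ⟨V, hV, hL⟩ := charlesSchnell_algebraicityLocus_iUnion_closed_holds f n p h𝒳 hS hSm hf W
  have hUV : U ⊆ ⋃ j, {t : ComplexPoints S | t.pt ∈ V j} := by
    rw [← hL]
    exact fun t ht => hUA t ht
  obtain ⟨j, hj⟩ := exists_eq_univ_of_isOpen_subset_iUnion hV hU hUne hUV
  have ht : t ∈ ⋃ j, {t : ComplexPoints S | t.pt ∈ V j} := Set.mem_iUnion.2 ⟨j, by simp [hj]⟩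
  rw [← hL] at ht
  exact ht

/-! ### Theorem 1′ — the Remark-(7.5) form: a seed for `a·W + H`, `H` algebraic on every fibre -/

/-- (Private.) Linear algebra in the submodule of algebraic classes: if `a ≠ 0` is rational, `h` and
`(a : ℂ) • w + h` are algebraic, then `w` is algebraic. [cite: Bloch1972Semiregularity, Remark (7.5)] -/
private theorem mem_algebraicClasses_of_smul_add {X : SchemeOver ℂ} {p : ℕ} {a : ℚ} (ha : a ≠ 0)
    {w h : complexBetti X (2 * p)} (hh : h ∈ algebraicClasses X p)
    (hs : (a : ℂ) • w + h ∈ algebraicClasses X p) : w ∈ algebraicClasses X p := by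
  have ha' : (a : ℂ) ≠ 0 := by exact_mod_cast ha
  have h1 : (a : ℂ) • w ∈ algebraicClasses X p := by
    have := Submodule.sub_mem _ hs hh
    rwa [add_sub_cancel_right] at this
  have h2 := Submodule.smul_mem (algebraicClasses X p) ((a : ℂ)⁻¹) h1
  rwa [smul_smul, inv_mul_cancel₀ ha', one_smul] at h2

/-- **THEOREM 1′ (CM-anchored transfer, Bloch's Remark (7.5) form).** As Theorem 1 of `CMAnchoredChain.lean`
(`hodgeClass_algebraic_of_blochSeed_on_cmDenseFamily`, the case `a = 1`, `H = 0`), but the seed at the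
fibre `𝒳_{s₀} ≅ A₀` carries `e₀^*((a·W + H)|_{𝒳_{s₀}})` for a rational `a ≠ 0` and a global class `H` whose
fibre restrictions are rational, of type `(p,p)` and ALGEBRAIC on every fibre (the «trivially transported»
part — Bloch: «there exist integers `a, b`, `a ≠ 0`, such that `a z₀ + b l₀ᵖ` is the class of a subscheme
`Z₀ ⊂ X₀` which is semi-regular and a local complete intersection», `l₀` the polarization; here any
fibrewise-algebraic `H`, e.g. a power of a relative polarization class): THEN again `W|_{𝒳_t}` is algebraic
for every `t` and `c ∈ algebraicClasses A p` (Bloch's fact at the anchor gives an open set of algebraicity of `(a·W + H)|`, the DISCHARGED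
`charlesSchnell_algebraicityLocus_iUnion_closed_holds` + Baire spread it, subtract `H|_{𝒳_t}`, divide by `a`). This is the form a computed seed `[Z] = q·hⁿ + w` of the cell (`HasBlochSeedAt`) feeds.
[cite: Bloch1972Semiregularity, Thm. (7.4) and Remark (7.5) (p. 65)] [cite: Deligne1982HodgeCycles, Prop. 6.1 (a)(b)] -/
theorem hodgeClass_algebraic_of_blochSeed_on_cmDenseFamily_of_smul_add {A : AbelianVariety ℂ} {p : ℕ}
    (hB : BlochSemiregularSpread A.dim p) {c : complexBetti A.X (2 * p)} {𝒳 S : SchemeOver ℂ}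
    {f : 𝒳 ⟶ S} (s₁ : ComplexPoints S) (e : A.X ≅ fiberOver f s₁) (W : complexBetti 𝒳 (2 * p))
    (hf : IsSmoothProjectiveFamily f A.dim) (h𝒳 : IsQuasiProjectiveOver 𝒳) (hS : IsQuasiProjectiveOver S)
    [IrreducibleSpace S.left] (hSm : Smooth S.hom)
    (hW : ∀ s : ComplexPoints S, IsRationalClass (Res[f, s, 2 * p, W]) ∧
      IsOfHodgeType A.dim (fiberOver f s) (2 * p) p p (Res[f, s, 2 * p, W]))
    (hWc : complexBetti.map e.hom (2 * p) (Res[f, s₁, 2 * p, W]) = c)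
    (a : ℚ) (ha : a ≠ 0) (H : complexBetti 𝒳 (2 * p))
    (hH : ∀ s : ComplexPoints S, IsRationalClass (Res[f, s, 2 * p, H]) ∧
      IsOfHodgeType A.dim (fiberOver f s) (2 * p) p p (Res[f, s, 2 * p, H]) ∧
      Res[f, s, 2 * p, H] ∈ algebraicClasses (fiberOver f s) p)
    (s₀ : ComplexPoints S) (A₀ : AbelianVariety ℂ) (e₀ : A₀.X ≅ fiberOver f s₀) (hdim : A₀.dim = A.dim)
    (Z : Scheme.{0}) (i : Z ⟶ A₀.X.left) (hi : IsClosedImmersion i) (hreg : IsRegularImmersionOfCodim i p)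
    (hZ : IsIntegral Z) (hcodim : ∀ z ∈ Set.range i.base, (p : ℕ∞) ≤ Order.coheight z)
    (hsr : IsBlochSemiregular i A₀.dim p)
    (hx : complexBetti.map e₀.hom (2 * p) (Res[f, s₀, 2 * p, (a : ℂ) • W + H]) ∈
      classesSupportedOn A₀.X (Set.range i.base) (2 * p)) :
    (∀ t : ComplexPoints S, Res[f, t, 2 * p, W] ∈ algebraicClasses (fiberOver f t) p) ∧
      c ∈ algebraicClasses A.X p := by
  have hW' : ∀ s : ComplexPoints S, IsRationalClass (Res[f, s, 2 * p, (a : ℂ) • W + H]) ∧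
      IsOfHodgeType A.dim (fiberOver f s) (2 * p) p p (Res[f, s, 2 * p, (a : ℂ) • W + H]) := fun s ↦ by
    rw [map_add, map_smul]
    exact ⟨((hW s).1.smul a).add (hH s).1,
      ((hW s).2.smul (a : ℂ)).add (hf.isSmoothProjective s) (hH s).2.1⟩
  rw [hdim] at hsr
  obtain ⟨U, hU, hs₀, hUA⟩ :=
    hB A₀.X Z i (complexBetti.map e₀.hom (2 * p) (Res[f, s₀, 2 * p, (a : ℂ) • W + H])) 𝒳 S f s₀ e₀
      ((a : ℂ) • W + H) hi hreg hZ hcodim hsr hx hf h𝒳 hS hSm hW' rfl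
  have hall : ∀ t : ComplexPoints S,
      Res[f, t, 2 * p, (a : ℂ) • W + H] ∈ algebraicClasses (fiberOver f t) p :=
    forall_mem_algebraicClasses_of_isOpen f A.dim p h𝒳 hS hSm hf _ hU ⟨s₀, hs₀⟩ hUA
  have hallW : ∀ t : ComplexPoints S, Res[f, t, 2 * p, W] ∈ algebraicClasses (fiberOver f t) p :=
    fun t ↦ mem_algebraicClasses_of_smul_add ha (hH t).2.2 (by
      have := hall t
      rwa [map_add, map_smul] at this)
  refine ⟨hallW, ?_⟩
  rw [← hWc]
  exact (mem_algebraicClasses_map_iff_of_iso e).2 (hallW s₁)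

/-! ### The ∀-form of the cell's open input, BY NAME (family-aware, Remark (7.5) shape) -/

/-- **`UniformCMBlochSeeds` — «on every Mumford–Tate family of abelian varieties, at every CM fibre, every
flat rational `(p,p)` class is — up to a rational scalar `a ≠ 0` and a fibrewise-algebraic global class
`H` — either zero or carried by ONE integral Bloch-semiregular local complete intersection», the ∀-form of
the cell's open input (a hypothesis BY NAME; OPEN; never asserted).** Antecedents = exactly the family
clauses of `IsCMDenseMumfordTateFamilyFor` (smooth projective family of `m`-dimensional abelian varieties
with `𝒳`, `S` quasi-projective, `S` smooth irreducible, CM fibres DENSE — Deligne LNM 900 Prop. 6.1 /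
Charles–Schnell Thm. 11.5.11) + a global `W` fibrewise rational `(p,p)` + a CM fibre `A₀ ≅ 𝒳_{s₀}`
(`Milne1999.IsOfCMType`: «of CM-type if and only if its Mumford-Tate group is a torus», Deligne §5;
Moonen–Oort §3: «the special points are precisely the CM points»); conclusion = Bloch's Remark (7.5) «there
exist integers `a, b`, `a ≠ 0`, such that `a z₀ + b l₀ᵖ` is the class of a subscheme `Z₀ ⊂ X₀` which is
semi-regular and a local complete intersection», with `b l₀ᵖ` generalised to any global `H` algebraic on
every fibre, and the vanishing alternative `e₀^*((a·W + H)|_{𝒳_{s₀}}) = 0` kept explicit. SCOPE NOTES (red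
team): (i) the NAIVE ∀-form «every non-zero rational `(p,p)` class `x` on a CM abelian variety is supported
on one integral semiregular lci» is FALSE — on `E × E`, `x = [E×0] - [0×E]` has `x² = -2 < 0`, so no
multiple of `x` is the class of an integral curve — whence the scalar `a` and the correction `H` (with
`H|_{A₀} = a[0×E] + …` the seed `E × 0`, a translated abelian subvariety, IS Bloch-semiregular); (ii) ONE
integral `Z` carries the corrected class: a `ℚ`-combination of several cycles is not enough (only the total
class is known to stay Hodge along the family) — the reducible-lci door is lit-1's
`BlochSemiregularSpreadOfSubscheme`; (iii) family-aware by necessity (the correction `H` must be algebraic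
along the whole family), like the general-structure team's `UniformBlochLiftAtCM`
(`GeneralStructureWiringBloch.lean`), which in addition asks algebraicity of `G|_{A₀}` beforehand (fed by
`HC_CM`) and ranges over all families with one abelian fibre (whence Catanese 2002); here the fibres are
abelian and the seed itself is the algebraic representative, so Theorem 2′ needs neither `HC_CM` nor
Catanese; (iv) degrees `1 ≤ p < m` only (the others are unconditional, Theorem 2′).
[cite: Bloch1972Semiregularity, Remark (7.5) (p. 65)] [cite: Deligne1982HodgeCycles, Prop. 6.1 and §5]
[cite: MoonenOort2013Torelli, §3 (special points of A_g = CM points)] -/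
@[conjecture] def UniformCMBlochSeeds : Prop :=
  ∀ (m p : ℕ) ⦃𝒳 S : SchemeOver ℂ⦄ (f : 𝒳 ⟶ S) (W : complexBetti 𝒳 (2 * p)) (s₀ : ComplexPoints S)
    (A₀ : AbelianVariety ℂ) (e₀ : A₀.X ≅ fiberOver f s₀),
    1 ≤ p → p < m → IsSmoothProjectiveFamily f m → IsQuasiProjectiveOver 𝒳 → IsQuasiProjectiveOver S →
    IrreducibleSpace S.left → Smooth S.hom →
    (∀ s : ComplexPoints S, ∃ A' : AbelianVariety ℂ, A'.dim = m ∧ Nonempty (A'.X ≅ fiberOver f s)) →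
    (∀ s : ComplexPoints S, IsRationalClass (Res[f, s, 2 * p, W]) ∧
      IsOfHodgeType m (fiberOver f s) (2 * p) p p (Res[f, s, 2 * p, W])) →
    Dense (cmLocus f m) → A₀.dim = m → IsOfCMType A₀ →
    ∃ (a : ℚ) (H : complexBetti 𝒳 (2 * p)), a ≠ 0 ∧
      (∀ s : ComplexPoints S, IsRationalClass (Res[f, s, 2 * p, H]) ∧
        IsOfHodgeType m (fiberOver f s) (2 * p) p p (Res[f, s, 2 * p, H]) ∧
        Res[f, s, 2 * p, H] ∈ algebraicClasses (fiberOver f s) p) ∧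
      (complexBetti.map e₀.hom (2 * p) (Res[f, s₀, 2 * p, (a : ℂ) • W + H]) = 0 ∨
        ∃ (Z : Scheme.{0}) (i : Z ⟶ A₀.X.left), IsClosedImmersion i ∧ IsRegularImmersionOfCodim i p ∧
          IsIntegral Z ∧ (∀ z ∈ Set.range i.base, (p : ℕ∞) ≤ Order.coheight z) ∧
          IsBlochSemiregular i A₀.dim p ∧
          complexBetti.map e₀.hom (2 * p) (Res[f, s₀, 2 * p, (a : ℂ) • W + H]) ∈
            classesSupportedOn A₀.X (Set.range i.base) (2 * p))

/-! ### Theorem 2′ — the ∀-form: CM density is used, not only quoted -/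

/-- **THEOREM 2′ (the meta-chain as an implication) — RESTATEMENT-GRADE ASSEMBLY: its hypothesis (3) is
`≥ HC_CM` in degrees `1 ≤ p < dim` (red team RED-1 v3 V3-T2, kernel: `UniformCMBlochSeeds.mem_algebraicClasses`
below, via the CONSTANT family over `Spec ℂ`); the content row is THEOREM 1′ (positive-dimensional families:
one semiregular seed at ONE CM fibre ⟹ algebraic on EVERY member).** Granted, BY NAME, (1) Deligne LNM 900 Prop. 6.1 =
Charles–Schnell Thm. 11.5.11 with its density clause (`deligne1982_cmDenseMumfordTateFamilies`: the
Mumford–Tate family through `A` carrying the class, over a smooth irreducible quasi-projective base, CM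
fibres DENSE — the «Hodge-locus components are special, CM points dense on them» arrow in the form the
spreading step can consume), (2) Bloch 1972 Thm. (7.4)/(7.5) in every dimension and codimension
(`∀ n p, BlochSemiregularSpread n p`), and (3) the cell's open input in ∀-form (`UniformCMBlochSeeds`): the
Hodge conjecture holds for every complex abelian variety (`HodgeConjectureFor A.dim A.X`: a Hodge model
exists — the tree's theorem `nonempty_hodgeModel_holds` — and every rational `(p,p)` class is algebraic).
Proof, degree by degree: `p = 0` — `algebraicClasses_zero`; `p = dim A ≥ 1` —
`mem_algebraicClasses_of_degree_top`; `p > dim A` — `H²ᵖ = 0` (`subsingleton_complexBetti`); `1 ≤ p < dim A`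
— take the family of (1), a CM fibre `𝒳_{s₀} ≅ A₀` (density ⟹ `cmLocus` non-empty:
`IsCMDenseMumfordTateFamilyFor.cmLocus_nonempty` — HERE CM density is consumed), (3) gives `a, H` and either
`(a·W + H)|` vanishes at `s₀`, hence everywhere (flatness: `FiberClass.cls_ne_zero_of_isSmoothProjectiveFamily`)
so `a·W|_{𝒳_{s₁}} = -H|_{𝒳_{s₁}}` is algebraic, or a seed, and Theorem 1′ concludes. Nothing is asserted;
the three hypotheses are the trust base and (3) is open. «HC_CM» is not a separate input (the seed is the
algebraic representative at the CM fibre) — but (3), applied to the constant family `A₀ ⟶ Spec ℂ` (one CM fibre,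
dense CM locus), already CONTAINS HC_CM in degrees `1 ≤ p < dim` (`UniformCMBlochSeeds.mem_algebraicClasses`),
so this theorem is an assembly, not a reduction of HC_CM to something weaker. [cite: Deligne1982HodgeCycles, Prop. 6.1 and proof (pp. 71–73)]
[cite: CharlesSchnell2014Notes, Thm. 11.5.11] [cite: Bloch1972Semiregularity, Thm. (7.4) and Remark (7.5)]
[cite: CarlsonMullerStachPeters2017, Prop. 17.1.2 and Cor. 17.1.5] -/
theorem hodgeConjectureFor_abelian_of_cmDense_of_blochSpread_of_uniformCMBlochSeeds
    (hfam : deligne1982_cmDenseMumfordTateFamilies) (hB : ∀ n p : ℕ, BlochSemiregularSpread n p)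
    (hseed : UniformCMBlochSeeds) (A : AbelianVariety ℂ) : HodgeConjectureFor A.dim A.X := by
  have hA : IsSmoothProjective A.dim A.X := AbelianVariety.isSmoothProjective_holds
  refine ⟨nonempty_hodgeModel_holds hA, fun p c hc hpp => ?_⟩
  rcases Nat.eq_zero_or_pos p with rfl | hp1
  · -- degree 0: every class is algebraic
    rw [algebraicClasses_zero]; trivial
  rcases lt_trichotomy p A.dim with hlt | heq | hgt
  · -- the honest range `1 ≤ p < dim A`: Deligne family, CM fibre (density), uniform seed, Theorem 1′
    obtain ⟨𝒳, S, f, hF⟩ := hfam A hA p c hc hpp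
    obtain ⟨s₀, A₀, ⟨e₀⟩, hdim₀, hcm₀⟩ := hF.cmLocus_nonempty
    obtain ⟨s₁, e, W, hf, h𝒳, hS, hirr, hSm, hab, hW, hWc, hD⟩ := hF
    haveI := hirr
    obtain ⟨a, H, ha, hH, hdisj⟩ :=
      hseed A.dim p f W s₀ A₀ e₀ hp1 hlt hf h𝒳 hS hirr hSm hab hW hD hdim₀ hcm₀
    rcases hdisj with h0 | ⟨Z, i, hi, hreg, hZ, hcodim, hsr, hx⟩
    · -- degenerate case: `(a·W + H)|` vanishes at `s₀`, hence at `s₁` (flatness), so `a·W| = -H|` there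
      have h0' : Res[f, s₀, 2 * p, (a : ℂ) • W + H] = 0 := by
        by_contra hne
        exact complexBetti.map_ne_zero_of_iso e₀ (2 * p) hne h0
      have h1 : Res[f, s₁, 2 * p, (a : ℂ) • W + H] = 0 := by
        by_contra h1
        exact FiberClass.cls_ne_zero_of_isSmoothProjectiveFamily f (2 * p) hf hirr hSm hS
          (continuous_globalSection f (2 * p) ((a : ℂ) • W + H)) (fun _ => rfl) (s₀ := s₁) h1 s₀ h0'
      have hWs₁ : Res[f, s₁, 2 * p, W] ∈ algebraicClasses (fiberOver f s₁) p :=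
        mem_algebraicClasses_of_smul_add ha (hH s₁).2.2 (by
          rw [map_add, map_smul] at h1
          rw [h1]; exact Submodule.zero_mem _)
      rw [← hWc]
      exact (mem_algebraicClasses_map_iff_of_iso e).2 hWs₁
    · exact (hodgeClass_algebraic_of_blochSeed_on_cmDenseFamily_of_smul_add (hB A.dim p) s₁ e W hf h𝒳 hS
        hSm hW hWc a ha H hH s₀ A₀ e₀ hdim₀ Z i hi hreg hZ hcodim hsr hx).2
  · -- top degree `p = dim A`
    subst heq
    exact mem_algebraicClasses_of_degree_top hA hp1 c
  · -- above the top degree: `H²ᵖ = 0`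
    haveI := subsingleton_complexBetti hA (show 2 * A.dim < 2 * p by omega)
    rw [Subsingleton.elim c 0]
    exact Submodule.zero_mem _

/-! ### Addendum (red team RED-1 v3, V3-T2, kernel): the ∀-form hypothesis alone contains HC_CM in degrees
`1 ≤ p < dim` — apply it to the CONSTANT family over `Spec ℂ` -/

section ConstantFamily

open MonoidalCategory
open Summit.HodgeConjecture.HodgeConjecture.Cruxes.HodgeAbelianVarieties.SubtorusGalleryBlochSeeds.Stubs
  (unit_base isSmoothProjectiveFamily_toUnit isIso_fiberι_toUnit)

/-- **`UniformCMBlochSeeds` ALONE (no Deligne family, no Bloch spreading) makes every rational `(p,p)` class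
on every CM abelian variety algebraic in degrees `1 ≤ p < dim`** (red team RED-1 v3 V3-T2; proof = red-1's probe
`RED1.Vacuity3.uniformCMBlochSeeds_mem_algebraicClasses`, re-typed here so that the caveat on Theorem 2′ is a
kernel statement of the tree): apply the hypothesis to the CONSTANT family `A₀ ⟶ Spec ℂ` (smooth projective of
relative dimension `dim A₀`, every fibre `≅ A₀` by `fiberι`, CM locus = the whole one-point base, hence dense)
with `W := c`; it returns `a ≠ 0` and a fibrewise-algebraic `H` with `a·c + H|` either zero or supported on a
closed subset of codimension `≥ p` (hence algebraic, `mem_supportedClasses_of_restrictCompl_eq_zero`); subtract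
`H|` and divide by `a`. So at point families the hypothesis is `⟺ HC_CM` (the vanishing disjunct absorbs, with
`H := -c`), and the deformation-theoretic content of this file lives in THEOREM 1′ only. Not vacuous (the
`E × E` witness against the naive form is absorbed by `H`). [cite: Bloch1972Semiregularity, Remark (7.5) (p. 65)] -/
theorem UniformCMBlochSeeds.mem_algebraicClasses (hseed : UniformCMBlochSeeds) (A₀ : AbelianVariety ℂ)
    (hcm : IsOfCMType A₀) {p : ℕ} (hp : 1 ≤ p) (hpd : p < A₀.dim) (c : complexBetti A₀.X (2 * p))
    (hc : IsRationalClass c) (hh : IsOfHodgeType A₀.dim A₀.X (2 * p) p p c) :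
    c ∈ algebraicClasses A₀.X p := by
  obtain ⟨hS, hsm, hirr⟩ := unit_base
  have hX := AbelianVariety.isSmoothProjective_holds (A := A₀)
  have h𝒳 : IsQuasiProjectiveOver A₀.X := IsQuasiProjectiveOver.of_isProjectiveOver hX.isProjectiveOver
  set f := CartesianMonoidalCategory.toUnit A₀.X with hfdef
  have hf : IsSmoothProjectiveFamily f A₀.dim := isSmoothProjectiveFamily_toUnit A₀
  have hfib : ∀ s : ComplexPoints (𝟙_ (SchemeOver ℂ)), IsIso (fiberι f s) := isIso_fiberι_toUnit A₀
  have hab : ∀ s : ComplexPoints (𝟙_ (SchemeOver ℂ)), ∃ A' : AbelianVariety ℂ, A'.dim = A₀.dim ∧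
      Nonempty (A'.X ≅ fiberOver f s) :=
    fun s ↦ by haveI := hfib s; exact ⟨A₀, rfl, ⟨(asIso (fiberι f s)).symm⟩⟩
  have hW : ∀ s : ComplexPoints (𝟙_ (SchemeOver ℂ)),
      IsRationalClass (Res[f, s, 2 * p, c]) ∧ IsOfHodgeType A₀.dim (fiberOver f s) (2 * p) p p (Res[f, s, 2 * p, c]) := by
    intro s
    haveI := hfib s
    exact ⟨(isRationalClass_map_iff_of_iso (asIso (fiberι f s))).2 hc,
      (isOfHodgeType_map_iff_of_iso (asIso (fiberι f s))).2 hh⟩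
  have hcmLocus : ∀ s : ComplexPoints (𝟙_ (SchemeOver ℂ)), s ∈ cmLocus f A₀.dim :=
    fun s ↦ by haveI := hfib s; exact ⟨A₀, ⟨(asIso (fiberι f s)).symm⟩, rfl, hcm⟩
  have hD : Dense (cmLocus f A₀.dim) := fun s ↦ subset_closure (hcmLocus s)
  let s₀ : ComplexPoints (𝟙_ (SchemeOver ℂ)) := Classical.arbitrary _
  haveI := hfib s₀
  set e₀ : A₀.X ≅ fiberOver f s₀ := (asIso (fiberι f s₀)).symm with he₀
  obtain ⟨a, H, ha, hH, hdisj⟩ :=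
    hseed A₀.dim p f c s₀ A₀ e₀ hp hpd hf h𝒳 hS hirr hsm hab hW hD rfl hcm
  -- the pulled-back correction is algebraic on `A₀`, and `e₀^*((a • c + H)|_{s₀}) = a • c + e₀^*(H|_{s₀})`
  have hH₀ : complexBetti.map e₀.hom (2 * p) (Res[f, s₀, 2 * p, H]) ∈ algebraicClasses A₀.X p :=
    (mem_algebraicClasses_map_iff_of_iso e₀).2 (hH s₀).2.2
  have hsplit : complexBetti.map e₀.hom (2 * p) (Res[f, s₀, 2 * p, (a : ℂ) • c + H]) =
      (a : ℂ) • c + complexBetti.map e₀.hom (2 * p) (Res[f, s₀, 2 * p, H]) := by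
    have hc' : complexBetti.map (asIso (fiberι f s₀)).inv (2 * p) (Res[f, s₀, 2 * p, c]) = c :=
      (asIso (fiberι f s₀)).complexBetti_map_inv_map_hom (2 * p) c
    rw [map_add, map_smul, map_add, map_smul, he₀, Iso.symm_hom, hc']
  have ha' : (a : ℂ) ≠ 0 := by exact_mod_cast ha
  have hsum : (a : ℂ) • c + complexBetti.map e₀.hom (2 * p) (Res[f, s₀, 2 * p, H]) ∈
      algebraicClasses A₀.X p := by
    rcases hdisj with h0 | ⟨Z, i, hi, -, -, hcodim, -, hx⟩
    · rw [← hsplit, h0]; exact Submodule.zero_mem _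
    · rw [← hsplit]
      exact mem_supportedClasses_of_restrictCompl_eq_zero (Scheme.Hom.isClosedEmbedding i).isClosed_range hcodim
        (LinearMap.mem_ker.1 ((mem_classesSupportedOn_range_iff A₀.X i (2 * p) _).1 hx))
  have h1 : (a : ℂ) • c ∈ algebraicClasses A₀.X p := by
    have := Submodule.sub_mem _ hsum hH₀
    rwa [add_sub_cancel_right] at this
  have h2 := Submodule.smul_mem _ (a : ℂ)⁻¹ h1
  rwa [smul_smul, inv_mul_cancel₀ ha', one_smul] at h2

end ConstantFamily

end Summit.Ventures.HSemireg

end
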